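import Literature.MathematicalPhysics.QuantumLattice.ChargeIndexExactSymmetry
import Literature.MathematicalPhysics.QuantumLattice.CoordinateSlabs
import HarnessLib

/-!
# The BBDF filling constraint for the Hubbard torus, assembled from the index theorem

Bachmann–Bols–De Roeck–Fraas, *A many-body index for quantum charge transport*, Comm. Math. Phys.
**375** (2019) 1249 (BBDF), §3.2 / Example 2: the Lieb–Schultz–Mattis theorem in every dimension as
a corollary of the index theorem (Theorem 2.1) for the unit translation. This file carries out that
specialisation for the named fact `bbdf2019_lsm_filling_hubbardTorus` (`HubbardLSMFilling.lean`) on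
top of the abstract exact-symmetry index theorem `exists_int_abs_expect_sub_le_of_exact_symmetry`
(`ChargeIndexExactSymmetry.lean`) and the model layer `HubbardTorusCharges.lean` (charges of slabs,
the unit translation `transOp`, `⟨Q_{[0]}⟩ = N_σ/L`). Everything here is PROVED; the two analytic
inputs of BBDF's Proposition 2.4 enter the final theorem as explicit hypotheses:

* `zIco L a b` — the window `[a, b) ⊂ ℤ` cast into `ℤ/L` (BBDF's intervals of coordinate values),
  with disjointness / union / translation / periodic-distance lemmas (`disjoint_zIco`,
  `zIco_union_zIco`, `image_add_one_zIco`, `le_circDist_of_mem_zIco`);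
* `transOp_conj_mem_carEvenSubalgebra` — translates of even local observables are even and local
  (`V 𝔄⁺(slab S) Vᴴ ⊆ 𝔄⁺(slab (S+1))`, from `relabel_mem_carEvenSubalgebra` of `CoordinateSlabs`);
* `lsm_index_core` — **BBDF Theorem 2.1 for the Hubbard torus at one volume** (§3.2): given local
  charge-fluctuation operators `K±` (Assumption (iv)) and clustering between the two strips
  (Assumption (v)), the filling per layer `N_σ/L` is within
  `(2π(8πε+δ)(L^d + 2‖K₋‖) + 2√(4πε+2δ) + 4πε+2δ)/4` of an integer; the dictionary is `T = Vᴴ`,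
  `Q̄₋ = Q_{[0,2w]} - K₋`, `Q_m = Q_{[2w+1,h-2w-2]}`, `Q̄₊ = Q_{[h-2w-1,h-1]} - K₊`,
  `Q̄ᵀ₋ = Q_{[1,2w]} - VK₋Vᴴ`, `Q̄ᵀ₊ = Q_{[h-2w-1,h]} - VK₊Vᴴ`, `D = -Q_{[0]} - VK₋Vᴴ + K₋`,
  `⟨D⟩ = -N_σ/L`, the support identity `V e^{2πiQ̄₋} Vᴴ = e^{2πiQ̄ᵀ₋} e^{2πiQ_{[2w+1]}} = e^{2πiQ̄ᵀ₋}`;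
* `bbdf2019_lsm_filling_of_inputs` — **the named fact from the two inputs of Prop. 2.4**, uniformly
  in the volume: clustering of even slab observables in the `x₁`-direction with constants depending
  only on `(d, t, U, μ, g)`, and, for every `k'`, dressing operators `K±` within `L/16` of the two
  boundaries of the half-torus with `‖(Q_Γ - K₋ - K₊)ψ - qψ‖ ≤ A L^{-k'}`; the `O(L^{-∞})` bookkeeping
  (`k' = 2k + d`, `δ = C L^d e^{-w/ξ}`, `x^p e^{-cx} ≤ p!/c^p`, small volumes by `dist(x,ℤ) ≤ 1/2`).

Design note (instances): the generic CAR-algebra lemmas carry the `DecidableEq` instance derived from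
the linear order, whereas instance search on the concrete torus finds the computable
`instDecidableEqLex` (see the module docstring of `HubbardTorusCharges`); the matrix `1` and the
`L²`-operator norm depend syntactically on this instance. Inside `lsm_index_core` the linear-order
instance is pinned (`letI`), the statement-level norm `‖K₋‖` is frozen by `generalize`, and the
translation identities `VᴴV = VVᴴ = 1` are taken from the generic `relabelOp` lemmas.

## References

* S. Bachmann, A. Bols, W. De Roeck, M. Fraas, Comm. Math. Phys. **375** (2019) 1249–1272,
  arXiv:1810.07351: Theorem 2.1, §2.4 (Prop. 2.4), §3.2 (Example 2), §4.2 (eqs. (4.5)–(4.8)), §4.4.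
  [BachmannEtAl2019]
* The tree: `ChargeIndexExactSymmetry` (the index theorem for an exact symmetry),
  `HubbardTorusCharges` (`setCharge`, `slab`, `transOp`, `expect_setCharge_slab_zero`,
  `exp_two_pi_I_smul_setCharge`, `transOp_mul_setCharge_mul_conjTranspose`),
  `HubbardLSMFillingProofs` (`relabelOp`, `lsmShift`), `FermionRelabelling` (`relabel`),
  `FermionTraceFactorization` (`carEvenSubalgebra`, `commute_of_mem_carEvenSubalgebra`),
  `ApproximateEigenvectorLemmas` (`eucNorm`, `conjTranspose_mul_exp_mul`), `CoordinateSlabs`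
  (`relabel_mem_carEvenSubalgebra`, `map_orbSet`); Mathlib
  `Real.pow_div_factorial_le_exp`, `abs_sub_round`, `ZMod.intCast_eq_intCast_iff_dvd_sub`,
  `ZMod.val_intCast`, `AlgHom.map_adjoin`.
-/

noncomputable section

namespace Literature.MathematicalPhysics.QuantumLattice

open Matrix Complex Finset HubbardWave0
open scoped Matrix.Norms.L2Operator ComplexOrder Real

/-! ### Integer windows on `ℤ/L` -/

section Windows

variable {L : ℕ}

/-- The image in `ℤ/L` of the integer window `[a, b)` (BBDF's intervals `[a, b] = {a ≤ x₁ ≤ b}` of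
coordinate values, with `ℤ_L` identified with `{-L/2+1, …, L/2}`, §2.1.1). [cite: BachmannEtAl2019, §2.1.1] -/
def zIco (L : ℕ) (a b : ℤ) : Finset (ZMod L) := (Finset.Ico a b).image fun x : ℤ => (x : ZMod L)

/-- Membership in a window. [folklore] -/
theorem mem_zIco {a b : ℤ} {z : ZMod L} : z ∈ zIco L a b ↔ ∃ x : ℤ, a ≤ x ∧ x < b ∧ (x : ZMod L) = z := by
  simp [zIco, Finset.mem_Ico, and_assoc]

/-- Integers of the window belong to it. [folklore] -/
theorem intCast_mem_zIco {a b x : ℤ} (h₁ : a ≤ x) (h₂ : x < b) : (x : ZMod L) ∈ zIco L a b :=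
  mem_zIco.2 ⟨x, h₁, h₂, rfl⟩

/-- **Casting is injective on windows of length `≤ L`.** [folklore] -/
theorem int_eq_of_cast_eq {x y : ℤ} (h : (x : ZMod L) = y) (h₁ : x - y < L) (h₂ : y - x < L) : x = y := by
  rw [ZMod.intCast_eq_intCast_iff_dvd_sub] at h
  obtain ⟨k, hk⟩ := h
  rcases lt_trichotomy k 0 with hk0 | hk0 | hk0
  · nlinarith
  · subst hk0; linarith
  · nlinarith

/-- Disjoint integer windows inside one period give disjoint windows of `ℤ/L`. [folklore] -/
theorem disjoint_zIco {a b c e : ℤ} (h₁ : b ≤ c) (h₂ : e ≤ a + L) : Disjoint (zIco L a b) (zIco L c e) := by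
  rw [Finset.disjoint_left]
  intro z hz hz'
  obtain ⟨x, hax, hxb, rfl⟩ := mem_zIco.1 hz
  obtain ⟨y, hcy, hye, hxy⟩ := mem_zIco.1 hz'
  have := int_eq_of_cast_eq hxy (by linarith) (by linarith)
  linarith

/-- Adjacent windows merge. [folklore] -/
theorem zIco_union_zIco {a b c : ℤ} (hab : a ≤ b) (hbc : b ≤ c) : zIco L a b ∪ zIco L b c = zIco L a c := by
  rw [zIco, zIco, zIco, ← Finset.image_union, Finset.Ico_union_Ico_eq_Ico hab hbc]

/-- Sub-windows. [folklore] -/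
theorem zIco_subset_zIco {a b a' b' : ℤ} (ha : a' ≤ a) (hb : b ≤ b') : zIco L a b ⊆ zIco L a' b' :=
  Finset.image_subset_image (Finset.Ico_subset_Ico ha hb)

/-- The unit translation shifts windows. [folklore] -/
theorem image_add_one_zIco (a b : ℤ) : (zIco L a b).image (fun z => z + 1) = zIco L (a + 1) (b + 1) := by
  rw [zIco, zIco, Finset.image_image, ← Finset.image_add_right_Ico, Finset.image_image]
  congr 1
  funext x
  simp

/-- A window of length one is a singleton. [folklore] -/
theorem zIco_self_add_one (a : ℤ) : zIco L a (a + 1) = {(a : ZMod L)} := by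
  have h : Finset.Ico a (a + 1) = {a} := by
    ext x; simp only [Finset.mem_Ico, Finset.mem_singleton]; omega
  rw [zIco, h, Finset.image_singleton]

/-- The value of a difference of window points: for `0 ≤ y - x < L`, `(↑y - ↑x).val = y - x`.
[folklore] -/
theorem val_cast_sub_cast [NeZero L] {x y : ℤ} (h₁ : x ≤ y) (h₂ : y - x < L) :
    (((y : ZMod L) - (x : ZMod L)).val : ℤ) = y - x := by
  rw [← Int.cast_sub, ZMod.val_intCast, Int.emod_eq_of_lt (by linarith) h₂]

/-- **Separation of windows**: if `[a, b)` and `[c, e)` lie in one period, `a ≤ b ≤ c ≤ e ≤ a + L`,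
with gaps forcing periodic distance `≥ r` on both sides (`b + r ≤ c + 1`, `e + r ≤ a + L + 1`), then
their images are at periodic distance `≥ r`. [folklore] -/
theorem le_circDist_of_mem_zIco [NeZero L] {a b c e : ℤ} {r : ℕ} (hbc : b ≤ c) (hper : e ≤ a + L)
    (h₁ : b + r ≤ c + 1) (h₂ : e + r ≤ a + L + 1)
    {z z' : ZMod L} (hz : z ∈ zIco L a b) (hz' : z' ∈ zIco L c e) : r ≤ circDist z z' := by
  obtain ⟨x, hax, hxb, rfl⟩ := mem_zIco.1 hz
  obtain ⟨y, hcy, hye, rfl⟩ := mem_zIco.1 hz'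
  unfold circDist
  have hyx : (((y : ZMod L) - (x : ZMod L)).val : ℤ) = y - x := val_cast_sub_cast (by linarith) (by linarith)
  have hxy : (((x : ZMod L) - (y : ZMod L)).val : ℤ) = x + L - y := by
    have e1 : ((x : ZMod L) - (y : ZMod L)) = ((x + L : ℤ) : ZMod L) - (y : ZMod L) := by
      push_cast; simp
    rw [e1, val_cast_sub_cast (by linarith) (by linarith)]
  refine le_min ?_ ?_
  · have : (r : ℤ) ≤ (((x : ZMod L) - (y : ZMod L)).val : ℤ) := by rw [hxy]; linarith
    exact_mod_cast this
  · have : (r : ℤ) ≤ (((y : ZMod L) - (x : ZMod L)).val : ℤ) := by rw [hyx]; linarith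
    exact_mod_cast this

end Windows

/-! ### Translates of local observables on the torus -/

section TorusConj

open FermionTorus

variable {d L : ℕ} [NeZero L]

/-- **Translates of local observables are local**: `V X Vᴴ ∈ 𝔄⁺(slab (S + 1))` for
`X ∈ 𝔄⁺(slab S)`, `V` the unit translation. [folklore] -/
theorem transOp_conj_mem_carEvenSubalgebra (i₀ : Fin d) {S : Finset (ZMod L)}
    {X : Matrix (Finset (Orb (FermionTorus d L))) (Finset (Orb (FermionTorus d L))) ℂ}
    (hX : X ∈ carEvenSubalgebra (orbSet (slab i₀ S))) :
    transOp i₀ * X * (transOp (L := L) i₀)ᴴ ∈ carEvenSubalgebra (orbSet (slab i₀ (S.image fun a => a + 1))) := by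
  have h := relabel_mem_carEvenSubalgebra (lsmShift (L := L) i₀) hX
  rw [relabel_eq_relabelOp_conj, lsmShift_eq_mapEquiv, map_orbSet, map_siteShift_slab] at h
  exact h

end TorusConj

/-! ### Normalisation of a ground state -/

section Normalise

variable {n : Type*} [Fintype n] [DecidableEq n]

/-- A ground-state vector in a subspace can be normalised inside the subspace. [folklore] -/
theorem exists_unit_groundStateVector {A : Matrix n n ℂ} {ψ : n → ℂ} (hψ : A.IsGroundStateVector ψ)
    {K : Submodule ℂ (n → ℂ)} (hK : ψ ∈ K) :
    ∃ ψ₁ : n → ℂ, A.IsGroundStateVector ψ₁ ∧ ψ₁ ∈ K ∧ star ψ₁ ⬝ᵥ ψ₁ = 1 := by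
  have hne : eucNorm ψ ≠ 0 := by
    intro h0
    apply hψ.1
    have : (WithLp.toLp 2 ψ : EuclideanSpace ℂ n) = 0 := norm_eq_zero.1 h0
    exact (WithLp.toLp_eq_zero (p := 2)).1 this
  set c : ℂ := (((eucNorm ψ)⁻¹ : ℝ) : ℂ) with hc
  have hc0 : c ≠ 0 := by
    rw [hc]; exact_mod_cast inv_ne_zero hne
  refine ⟨c • ψ, ⟨smul_ne_zero hc0 hψ.1, ?_⟩, K.smul_mem c hK, ?_⟩
  · rw [mulVec_smul, hψ.2, smul_comm]
  · rw [star_smul, smul_dotProduct, dotProduct_smul, star_dotProduct_self_eq_eucNorm_sq, hc]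
    simp only [Complex.star_def, Complex.conj_ofReal, smul_eq_mul]
    have h : (eucNorm ψ : ℂ) ≠ 0 := by exact_mod_cast hne
    push_cast
    rw [← mul_assoc, ← pow_two, inv_pow, inv_mul_cancel₀ (pow_ne_zero 2 h)]

end Normalise

/-! ### The index theorem on the torus: one volume -/

/-- The fermionic torus has `L^d` sites (private copy of `card_fermionTorus` of
`HubbardHubbardModelEtaPairingProofs`, not imported here). [folklore] -/
private theorem fintypeCard_fermionTorus (d L : ℕ) : Fintype.card (FermionTorus d L) = L ^ d := by
  change Fintype.card (Fin d → Fin L) = L ^ d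
  rw [Fintype.card_fun, Fintype.card_fin, Fintype.card_fin]

section Core

open FermionTorus

variable {d L : ℕ} [NeZero L]

omit [NeZero L] in
/-- Charges of sub-slabs are local in bigger slabs. [folklore] -/
theorem setCharge_slab_mem {i₀ : Fin d} (σ : Fin 2) {X Y : Finset (ZMod L)} (h : X ⊆ Y) :
    setCharge σ (slab i₀ X) ∈ carEvenSubalgebra (orbSet (slab i₀ Y : Finset (FermionTorus d L))) :=
  carEvenSubalgebra_mono (orbSet_mono (slab_mono i₀ h)) (setCharge_mem_carEvenSubalgebra σ _)

omit [NeZero L] in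
/-- Even observables of disjoint slabs commute. [folklore] -/
theorem commute_of_mem_slab {i₀ : Fin d} {X Y : Finset (ZMod L)} (h : Disjoint X Y)
    {a b : Matrix (Finset (Orb (FermionTorus d L))) (Finset (Orb (FermionTorus d L))) ℂ}
    (ha : a ∈ carEvenSubalgebra (orbSet (slab i₀ X))) (hb : b ∈ carEvenSubalgebra (orbSet (slab i₀ Y))) :
    Commute a b :=
  commute_of_mem_carEvenSubalgebra ha ((carEvenSubalgebra_le_carSubalgebra _) hb)
    (disjoint_orbSet (disjoint_slab h))

omit [NeZero L] in
/-- Charges of disjoint windows add. [folklore] -/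
theorem setCharge_slab_union {i₀ : Fin d} (σ : Fin 2) {X Y : Finset (ZMod L)} (h : Disjoint X Y) :
    setCharge σ (slab i₀ (X ∪ Y) : Finset (FermionTorus d L)) = setCharge σ (slab i₀ X) + setCharge σ (slab i₀ Y) := by
  rw [← setCharge_union (disjoint_slab h)]
  congr 1
  ext x
  simp [mem_slab, Finset.mem_union]

/-- **The BBDF index theorem for the Hubbard torus, one volume (LSM case, §3.2).** Let `ψ` be the
normalised unique gapped ground state of `H(t,U) - μN` on `ℤ_L^d`, in the joint sector
`szSector N M`, and fix a direction `i₀`, a spin `σ` and scales `1 ≤ w`, `5w + 2 ≤ h`,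
`2h ≤ L` (in the application `h = L/2`, `w = L/16`). Suppose given
* local charge fluctuation operators (BBDF Assumption (iv) / Prop. 2.4): Hermitian `K₋`, `K₊`, even
  and supported in the slabs over `[-w, w]` and `[h-1-w, h-1+w]`, with
  `‖(Q^σ_Γ - K₋ - K₊)ψ - qψ‖₂ ≤ ε` for the half-space `Γ = {0 ≤ x_{i₀} < h}`;
* clustering (Assumption (v)) between the even algebras of the slabs over `S₋ = [-w, 2w]` and
  `S₊ = [h-2w-1, h+w]`: `|⟨ab⟩ - ⟨a⟩⟨b⟩| ≤ δ‖a‖‖b‖`.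
Then the filling per transverse layer `N_σ/L` (`N_↑ = N/2 + M`, `N_↓ = N/2 - M`) is within
`(2π(8πε + δ)(L^d + 2‖K₋‖) + 2√(4πε + 2δ) + 4πε + 2δ)/4` of an integer. This is
`exists_int_abs_expect_sub_le_of_exact_symmetry` for `T = Vᴴ` (`V` the unit translation),
`Q̄₋ = Q_{[0,2w]} - K₋`, `Q_m = Q_{[2w+1, h-2w-2]}`, `Q̄₊ = Q_{[h-2w-1,h-1]} - K₊`,
`Q̄ᵀ₋ = Q_{[1,2w]} - VK₋Vᴴ`, `Q̄ᵀ₊ = Q_{[h-2w-1,h]} - VK₊Vᴴ`, so that `D = Q̄ᵀ₋ - Q̄₋ = -Q_{[0]} - VK₋Vᴴ + K₋`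
has `⟨D⟩ = -⟨Q_{[0]}⟩ = -N_σ/L` (BBDF §3.2: `T₋ = -Q_{[0]}`, `⟨Q_{[0]}⟩ = L⁻¹⟨Q_Λ⟩`).
[cite: BachmannEtAl2019, Theorem 2.1, Prop. 2.4 and §3.2 (Example 2)] -/
theorem lsm_index_core (i₀ : Fin d) {t U μ g : ℝ}
    (hgap : (hubbardTorusWith d L t U μ).HasSpectralGap g)
    {ψ : Fock (Orb (FermionTorus d L))} (hψ : (hubbardTorusWith d L t U μ).IsGroundStateVector ψ)
    (hψ1 : star ψ ⬝ᵥ ψ = 1) {N : ℕ} {M : ℝ} (hmem : ψ ∈ szSector N M) (σ : Fin 2)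
    {w h : ℕ} (hw : 1 ≤ w) (hwh : 5 * w + 2 ≤ h) (hhL : 2 * h ≤ L)
    {Km Kp : Matrix (Finset (Orb (FermionTorus d L))) (Finset (Orb (FermionTorus d L))) ℂ}
    (hKm : Km.IsHermitian) (hKp : Kp.IsHermitian)
    (hKm_mem : Km ∈ carEvenSubalgebra (orbSet (slab i₀ (zIco L (-(w : ℤ)) (w + 1)))))
    (hKp_mem : Kp ∈ carEvenSubalgebra (orbSet (slab i₀ (zIco L ((h : ℤ) - 1 - w) (h + w)))))
    {q ε : ℝ} (hε : 0 ≤ ε)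
    (happrox : eucNorm ((setCharge σ (slab i₀ (zIco L 0 h)) - Km - Kp) *ᵥ ψ - (q : ℂ) • ψ) ≤ ε)
    {δ : ℝ} (hδ : 0 ≤ δ)
    (hcl : ∀ a ∈ carEvenSubalgebra (orbSet (slab i₀ (zIco L (-(w : ℤ)) (2 * w + 1)))),
      ∀ b ∈ carEvenSubalgebra (orbSet (slab i₀ (zIco L ((h : ℤ) - 2 * w - 1) (h + w + 1)))),
        ‖star ψ ⬝ᵥ ((a * b) *ᵥ ψ) - (star ψ ⬝ᵥ (a *ᵥ ψ)) * (star ψ ⬝ᵥ (b *ᵥ ψ))‖ ≤ δ * ‖a‖ * ‖b‖) :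
    ∃ m : ℤ, |(if σ = 0 then (N : ℝ) / 2 + M else (N : ℝ) / 2 - M) / L - m| ≤
      (2 * π * ((8 * π * ε + δ) * ((L : ℝ) ^ d + 2 * ‖Km‖)) +
        (2 * Real.sqrt (4 * π * ε + 2 * δ) + (4 * π * ε + 2 * δ))) / 4 := by
  /- Instance bookkeeping: the generic CAR-algebra lemmas carry the `DecidableEq` instance derived
  from the linear order, while instance search on the concrete torus finds the computable
  `instDecidableEqLex` (the `L²`-operator norm instance depends on it syntactically, not in value);
  we freeze the statement-level norm `‖K₋‖` and pin the former instance inside the proof (cf. the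
  design note of `HubbardTorusCharges`). -/
  generalize hBK : ‖Km‖ = BK
  letI instDO : DecidableEq (Orb (FermionTorus d L)) := LinearOrder.toDecidableEq
  have hKmB : ‖Km‖ ≤ BK := le_of_eq hBK
  -- the symmetry `T = Vᴴ`
  set V := transOp (L := L) i₀ with hVdef
  have hVV : Vᴴ * V = 1 := conjTranspose_relabelOp_mul_self (lsmShift (L := L) i₀)
  have hVV' : V * Vᴴ = 1 := relabelOp_mul_conjTranspose_self (lsmShift (L := L) i₀)
  have hT : (Vᴴ)ᴴ * Vᴴ = 1 := by rw [conjTranspose_conjTranspose, hVV']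
  obtain ⟨lam, hlam1, hVψ, hTψ⟩ := exists_transOp_mulVec_eq_smul i₀ hgap hψ
  -- windows (integer arithmetic facts)
  have hw' : (1 : ℤ) ≤ w := by exact_mod_cast hw
  have hwh' : 5 * (w : ℤ) + 2 ≤ h := by exact_mod_cast hwh
  have hhL' : 2 * (h : ℤ) ≤ L := by exact_mod_cast hhL
  set Smin := zIco L (-(w : ℤ)) (2 * w + 1) with hSmin
  set Spl := zIco L ((h : ℤ) - 2 * w - 1) (h + w + 1) with hSpl
  set Gm := zIco L 0 (2 * (w : ℤ) + 1) with hGm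
  set Gmid := zIco L (2 * (w : ℤ) + 1) ((h : ℤ) - 2 * w - 1) with hGmid
  set Gp := zIco L ((h : ℤ) - 2 * w - 1) h with hGp
  set GmT := zIco L 1 (2 * (w : ℤ) + 1) with hGmT
  set GpT := zIco L ((h : ℤ) - 2 * w - 1) (h + 1) with hGpT
  set G0 := zIco L 0 1 with hG0
  set G1 := zIco L (2 * (w : ℤ) + 1) (2 * w + 2) with hG1
  -- disjointness
  have hd_min_pl : Disjoint Smin Spl := disjoint_zIco (by linarith) (by linarith)
  have hd_min_mid : Disjoint Smin Gmid := disjoint_zIco le_rfl (by linarith)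
  have hd_mid_pl : Disjoint Gmid Spl := disjoint_zIco le_rfl (by linarith)
  have hd_m_mid : Disjoint Gm Gmid := disjoint_zIco le_rfl (by linarith)
  have hd_mT_mid : Disjoint GmT Gmid := disjoint_zIco le_rfl (by linarith)
  have hd_mmid_p : Disjoint (Gm ∪ Gmid) Gp := by
    rw [hGm, hGmid, zIco_union_zIco (by linarith) (by linarith)]
    exact disjoint_zIco le_rfl (by linarith)
  have hd_mTmid_pT : Disjoint (GmT ∪ Gmid) GpT := by
    rw [hGmT, hGmid, zIco_union_zIco (by linarith) (by linarith)]
    exact disjoint_zIco le_rfl (by linarith)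
  have hd_0_mT : Disjoint G0 GmT := disjoint_zIco le_rfl (by linarith)
  have hd_mT_1 : Disjoint GmT G1 := disjoint_zIco le_rfl (by linarith)
  have hd_1_WmT : Disjoint (zIco L (-(w : ℤ) + 1) (w + 1 + 1)) G1 := disjoint_zIco (by linarith) (by linarith)
  -- inclusions
  have hGm_sub : Gm ⊆ Smin := zIco_subset_zIco (by linarith) le_rfl
  have hGmT_sub : GmT ⊆ Smin := zIco_subset_zIco (by linarith) le_rfl
  have hWm_sub : zIco L (-(w : ℤ)) (w + 1) ⊆ Smin := zIco_subset_zIco le_rfl (by linarith)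
  have hWmT_sub : zIco L (-(w : ℤ) + 1) (w + 1 + 1) ⊆ Smin := zIco_subset_zIco (by linarith) (by linarith)
  have hGp_sub : Gp ⊆ Spl := zIco_subset_zIco le_rfl (by linarith)
  have hGpT_sub : GpT ⊆ Spl := zIco_subset_zIco le_rfl (by linarith)
  have hWp_sub : zIco L ((h : ℤ) - 1 - w) (h + w) ⊆ Spl := zIco_subset_zIco (by linarith) (by linarith)
  have hWpT_sub : zIco L ((h : ℤ) - 1 - w + 1) (h + w + 1) ⊆ Spl := zIco_subset_zIco (by linarith) le_rfl
  -- decompositions of windows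
  have hΓ : zIco L 0 h = Gm ∪ Gmid ∪ Gp := by
    rw [hGm, hGmid, hGp, zIco_union_zIco (by linarith) (by linarith), zIco_union_zIco (by linarith) (by linarith)]
  have hΓT : zIco L 1 ((h : ℤ) + 1) = GmT ∪ Gmid ∪ GpT := by
    rw [hGmT, hGmid, hGpT, zIco_union_zIco (by linarith) (by linarith), zIco_union_zIco (by linarith) (by linarith)]
  have hGm_split : Gm = G0 ∪ GmT := by rw [hG0, hGmT, hGm, zIco_union_zIco (by linarith) (by linarith)]
  have hGm_shift : Gm.image (fun a => a + 1) = GmT ∪ G1 := by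
    rw [hGm, image_add_one_zIco, hGmT, hG1, zIco_union_zIco (by linarith) (by linarith)]
    push_cast; ring_nf
  have hΓ_shift : (zIco L 0 h).image (fun a => a + 1) = zIco L 1 ((h : ℤ) + 1) := by
    rw [image_add_one_zIco]; push_cast; ring_nf
  -- the subalgebras and the operators
  set Sm := carEvenSubalgebra (orbSet (slab i₀ Smin : Finset (FermionTorus d L))) with hSmdef
  set Sp := carEvenSubalgebra (orbSet (slab i₀ Spl : Finset (FermionTorus d L))) with hSpdef
  set KmT := V * Km * Vᴴ with hKmT
  set KpT := V * Kp * Vᴴ with hKpT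
  set Qm := setCharge σ (slab i₀ Gm) - Km with hQm
  set Qmid := setCharge σ (slab i₀ Gmid : Finset (FermionTorus d L)) with hQmid
  set Qp := setCharge σ (slab i₀ Gp) - Kp with hQp
  set QmT := setCharge σ (slab i₀ GmT) - KmT with hQmT
  set QpT := setCharge σ (slab i₀ GpT) - KpT with hQpT
  -- memberships
  have hKmT_mem : KmT ∈ Sm := by
    have h := transOp_conj_mem_carEvenSubalgebra i₀ hKm_mem
    rw [image_add_one_zIco] at h
    exact carEvenSubalgebra_mono (orbSet_mono (slab_mono i₀ hWmT_sub)) h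
  have hKpT_mem : KpT ∈ Sp := by
    have h := transOp_conj_mem_carEvenSubalgebra i₀ hKp_mem
    rw [image_add_one_zIco] at h
    exact carEvenSubalgebra_mono (orbSet_mono (slab_mono i₀ hWpT_sub)) h
  have hKm_mem' : Km ∈ Sm := carEvenSubalgebra_mono (orbSet_mono (slab_mono i₀ hWm_sub)) hKm_mem
  have hKp_mem' : Kp ∈ Sp := carEvenSubalgebra_mono (orbSet_mono (slab_mono i₀ hWp_sub)) hKp_mem
  have hQm_mem : Qm ∈ Sm := Sm.sub_mem (setCharge_slab_mem σ hGm_sub) hKm_mem'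
  have hQmT_mem : QmT ∈ Sm := Sm.sub_mem (setCharge_slab_mem σ hGmT_sub) hKmT_mem
  have hQp_mem : Qp ∈ Sp := Sp.sub_mem (setCharge_slab_mem σ hGp_sub) hKp_mem'
  have hQpT_mem : QpT ∈ Sp := Sp.sub_mem (setCharge_slab_mem σ hGpT_sub) hKpT_mem
  have hQmid_mem : Qmid ∈ carEvenSubalgebra (orbSet (slab i₀ Gmid : Finset (FermionTorus d L))) :=
    setCharge_mem_carEvenSubalgebra σ _
  -- commutation
  have hSS : ∀ a ∈ Sm, ∀ b ∈ Sp, Commute a b := fun a ha b hb => commute_of_mem_slab hd_min_pl ha hb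
  have hmid_m : ∀ a ∈ Sm, Commute Qmid a := fun a ha => (commute_of_mem_slab hd_min_mid ha hQmid_mem).symm
  have hmid_p : ∀ b ∈ Sp, Commute Qmid b := fun b hb => commute_of_mem_slab hd_mid_pl hQmid_mem hb
  -- hermiticity
  have hKmT_h : KmT.IsHermitian := Matrix.isHermitian_mul_mul_conjTranspose V hKm
  have hKpT_h : KpT.IsHermitian := Matrix.isHermitian_mul_mul_conjTranspose V hKp
  have hQm_h : Qm.IsHermitian := (isHermitian_setCharge σ _).sub hKm
  have hQmT_h : QmT.IsHermitian := (isHermitian_setCharge σ _).sub hKmT_h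
  have hQp_h : Qp.IsHermitian := (isHermitian_setCharge σ _).sub hKp
  have hQpT_h : QpT.IsHermitian := (isHermitian_setCharge σ _).sub hKpT_h
  have hQmid_h : Qmid.IsHermitian := isHermitian_setCharge σ _
  -- the dressed charge
  have hQbar : Qm + Qmid + Qp = setCharge σ (slab i₀ (zIco L 0 h)) - Km - Kp := by
    rw [hΓ, setCharge_slab_union σ hd_mmid_p, setCharge_slab_union σ hd_m_mid, hQm, hQmid, hQp]
    abel
  have happrox' : eucNorm ((Qm + Qmid + Qp) *ᵥ ψ - (q : ℂ) • ψ) ≤ ε := by rw [hQbar]; exact happrox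
  -- the translate of the dressed charge
  have hVQ : ∀ S : Finset (ZMod L), V * setCharge σ (slab i₀ S) * Vᴴ =
      setCharge σ (slab i₀ (S.image fun a => a + 1) : Finset (FermionTorus d L)) :=
    fun S => transOp_mul_setCharge_mul_conjTranspose i₀ σ S
  have hQT : (Vᴴ)ᴴ * (Qm + Qmid + Qp) * Vᴴ = QmT + Qmid + QpT := by
    rw [conjTranspose_conjTranspose, hQbar, Matrix.mul_sub, Matrix.mul_sub, Matrix.sub_mul, Matrix.sub_mul,
      hVQ, hΓ_shift, hΓT, setCharge_slab_union σ hd_mTmid_pT, setCharge_slab_union σ hd_mT_mid, hQmT, hQmid,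
      hQpT, hKmT, hKpT]
    abel
  -- integrality of the middle charge
  have hmid : NormedSpace.exp ((2 * π * I) • Qmid) = 1 := exp_two_pi_I_smul_setCharge σ _
  -- the support identity of §4.4
  have hR4 : (Vᴴ)ᴴ * NormedSpace.exp ((2 * π * I) • Qm) * Vᴴ = NormedSpace.exp ((2 * π * I) • QmT) := by
    rw [conjTranspose_mul_exp_mul hT]
    have e1 : (Vᴴ)ᴴ * ((2 * π * I) • Qm) * Vᴴ = (2 * π * I) • QmT + (2 * π * I) • setCharge σ (slab i₀ G1) := by
      rw [conjTranspose_conjTranspose, Matrix.mul_smul, Matrix.smul_mul, hQm, Matrix.mul_sub, Matrix.sub_mul,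
        hVQ, hGm_shift, setCharge_slab_union σ hd_mT_1, hQmT, hKmT, ← smul_add]
      congr 1
      abel
    have hc : Commute ((2 * π * I) • QmT) ((2 * π * I) • setCharge σ (slab i₀ G1 : Finset (FermionTorus d L))) := by
      refine ((Commute.sub_left ?_ ?_).smul_left _).smul_right _
      · exact commute_setCharge σ σ _ _
      · have h1 := transOp_conj_mem_carEvenSubalgebra i₀ hKm_mem
        rw [image_add_one_zIco] at h1
        exact commute_of_mem_slab hd_1_WmT h1 (setCharge_mem_carEvenSubalgebra σ _)
    rw [e1, Matrix.exp_add_of_commute _ _ hc, exp_two_pi_I_smul_setCharge, Matrix.mul_one]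
  -- the index theorem
  obtain ⟨m, hm⟩ := exists_int_abs_expect_sub_le_of_exact_symmetry hψ1 hT hTψ hSS hδ hcl hQm_h hQmT_h
    hQp_h hQpT_h hQmid_h hQm_mem hQmT_mem hQp_mem hQpT_mem hmid_m hmid_p hε happrox' hQT hmid hR4
  -- the index is `-N_σ/L`
  set ν : ℝ := (if σ = 0 then (N : ℝ) / 2 + M else (N : ℝ) / 2 - M) / L with hν
  have hD : QmT - Qm = -setCharge σ (slab i₀ G0) - KmT + Km := by
    rw [hQmT, hQm, hGm_split, setCharge_slab_union σ hd_0_mT]; abel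
  have hexpD : star ψ ⬝ᵥ ((QmT - Qm) *ᵥ ψ) = -(ν : ℂ) := by
    have h0 : star ψ ⬝ᵥ (setCharge σ (slab i₀ G0 : Finset (FermionTorus d L)) *ᵥ ψ) = (ν : ℂ) := by
      have hG0' : G0 = {(0 : ZMod L)} := by rw [hG0, show (1 : ℤ) = 0 + 1 by ring, zIco_self_add_one, Int.cast_zero]
      rw [hG0', expect_setCharge_slab_zero i₀ hgap hψ hmem σ, hψ1, mul_one, hν]
    have hK : star ψ ⬝ᵥ (KmT *ᵥ ψ) = star ψ ⬝ᵥ (Km *ᵥ ψ) := by rw [hKmT]; exact expect_transOp_conj i₀ hgap hψ Km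
    rw [hD, add_mulVec, sub_mulVec, neg_mulVec, dotProduct_add, dotProduct_sub, dotProduct_neg, h0, hK]
    ring
  rw [hexpD] at hm
  have hre : (-(ν : ℂ)).re = -ν := by simp
  rw [hre] at hm
  -- restate the bound with the instances of this context (syntactic normalisation for `linarith`)
  have hm' : |-ν - (m : ℝ)| ≤ (2 * π * ((8 * π * ε + δ) * ‖QmT - Qm‖) +
      (2 * Real.sqrt (4 * π * ε + 2 * δ) + (4 * π * ε + 2 * δ))) / 4 := hm
  -- the norm of `D`
  have hDnorm : ‖QmT - Qm‖ ≤ (L : ℝ) ^ d + 2 * BK := by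
    rw [hD]
    have h1 : ‖setCharge σ (slab i₀ G0 : Finset (FermionTorus d L))‖ ≤ (L : ℝ) ^ d := by
      refine (norm_setCharge_le σ _).trans ?_
      have h := (Finset.card_le_univ (slab i₀ G0 : Finset (FermionTorus d L))).trans (fintypeCard_fermionTorus d L).le
      exact_mod_cast h
    have h2 : ‖KmT‖ ≤ BK := by
      rw [hKmT]; exact (norm_isometry_mul_mul_isometry_le hVV hT).trans hKmB
    calc ‖-setCharge σ (slab i₀ G0) - KmT + Km‖
        ≤ ‖-setCharge σ (slab i₀ G0) - KmT‖ + ‖Km‖ := norm_add_le _ _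
      _ ≤ ‖-setCharge σ (slab i₀ G0)‖ + ‖KmT‖ + ‖Km‖ := add_le_add (norm_sub_le _ _) le_rfl
      _ ≤ (L : ℝ) ^ d + BK + BK := by rw [norm_neg]; exact add_le_add (add_le_add h1 h2) hKmB
      _ = (L : ℝ) ^ d + 2 * BK := by ring
  refine ⟨-m, ?_⟩
  have e : |ν - ((-m : ℤ) : ℝ)| = |-ν - m| := by
    rw [Int.cast_neg, sub_neg_eq_add, ← abs_neg, neg_add, ← sub_eq_add_neg]
  rw [e]
  refine hm'.trans ?_
  have hpos : 0 ≤ 8 * π * ε + δ := by positivity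
  have h4 : (0 : ℝ) < 4 := by norm_num
  rw [div_le_div_iff_of_pos_right h4]
  have h2π : (0 : ℝ) ≤ 2 * π := by linarith [Real.pi_pos]
  have key := mul_le_mul_of_nonneg_left (mul_le_mul_of_nonneg_left hDnorm hpos) h2π
  linarith

end Core

/-! ### Elementary asymptotics -/

section Asymptotics

/-- `x^p e^{-cx} ≤ p!/c^p` for `x ≥ 0`, `c > 0` (from `y^p/p! ≤ e^y`; a private copy of the
statement in `BMOCarlesonProofs`). [folklore] -/
private theorem pow_mul_exp_neg_le {c : ℝ} (hc : 0 < c) (p : ℕ) {x : ℝ} (hx : 0 ≤ x) :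
    x ^ p * Real.exp (-(c * x)) ≤ p.factorial / c ^ p := by
  have h := Real.pow_div_factorial_le_exp (c * x) (by positivity) p
  rw [div_le_iff₀ (by positivity : (0 : ℝ) < p.factorial)] at h
  have he := Real.exp_pos (c * x)
  rw [Real.exp_neg, le_div_iff₀ (pow_pos hc p)]
  calc x ^ p * (Real.exp (c * x))⁻¹ * c ^ p = (c * x) ^ p * (Real.exp (c * x))⁻¹ := by
        rw [mul_pow]; ring
    _ ≤ (Real.exp (c * x) * p.factorial) * (Real.exp (c * x))⁻¹ :=
        mul_le_mul_of_nonneg_right h (inv_nonneg.2 he.le)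
    _ = p.factorial := by field_simp

/-- `√(K / y) ≤ √K / z` when `z² ≤ y`, `z > 0`. [folklore] -/
theorem sqrt_div_le_sqrt_div {K y z : ℝ} (hK : 0 ≤ K) (hz : 0 < z) (hzy : z ^ 2 ≤ y) :
    Real.sqrt (K / y) ≤ Real.sqrt K / z := by
  have hy : 0 < y := lt_of_lt_of_le (by positivity) hzy
  calc Real.sqrt (K / y) ≤ Real.sqrt (K / z ^ 2) := Real.sqrt_le_sqrt (by gcongr)
    _ = Real.sqrt K / z := by rw [Real.sqrt_div hK, Real.sqrt_sq hz.le]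

end Asymptotics

/-! ### From local charge fluctuations and clustering to the filling constraint -/

section Assembly

open FermionTorus

/-- **The BBDF filling constraint from its two analytic inputs.** If, for the unique gapped ground
states of the grand-canonical Hubbard Hamiltonian on the tori `ℤ_L^d`, one has
* *(clustering in the `x₁`-direction, BBDF Assumption (v) / Prop. 2.4 via Hastings–Koma)*: even
  observables of two slabs at periodic distance `r ≥ r₀` cluster up to `C L^d ‖A‖‖B‖ e^{-r/ξ}`,
  with `C, ξ, r₀` depending only on `d, t, U, μ, g`; and
* *(local charge fluctuations, BBDF Assumption (iv) / Prop. 2.4 via the quasi-adiabatic map `𝓘`)*: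
  for every `k'` a constant `A` (depending only on `d, t, U, μ, g, k'`) and, for `L ≥ 64`, even
  Hermitian operators `K₋`, `K₊` supported within `L/16` of the two boundaries of the half-torus
  `Γ = {0 ≤ x₁ < L/2}`, `‖K₋‖ ≤ A L^d`, with `‖(Q^σ_Γ - K₋ - K₊)ψ - qψ‖₂ ≤ A L^{-k'}`,
then the named fact `bbdf2019_lsm_filling_hubbardTorus` holds: BBDF Theorem 2.1 in the form
`lsm_index_core` at each large `L` of the sequence (with `k' = 2k + d`, `w = L/16`, `h = L/2`,
`δ = C L^d e^{-w/ξ}`), the elementary bounds `x^p e^{-cx} ≤ p!/c^p` for the exponentially small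
terms, and the trivial bound `dist(x, ℤ) ≤ 1/2` for the finitely many small `L`.
[cite: BachmannEtAl2019, Theorem 2.1, Proposition 2.4 and §3.2] -/
theorem bbdf2019_lsm_filling_of_inputs
    (hclus : ∀ (d : ℕ) (t U μ g : ℝ), 0 < g → ∃ Ccl ξ : ℝ, ∃ r₀ : ℕ, 0 < ξ ∧ 0 ≤ Ccl ∧
      ∀ (L : ℕ) [NeZero L] (i₀ : Fin d) (ψ : Fock (Orb (FermionTorus d L))),
        (hubbardTorusWith d L t U μ).HasSpectralGap g →
        (hubbardTorusWith d L t U μ).IsGroundStateVector ψ → star ψ ⬝ᵥ ψ = 1 →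
        ∀ (S₁ S₂ : Finset (ZMod L)) (r : ℕ), r₀ ≤ r → (∀ z ∈ S₁, ∀ z' ∈ S₂, r ≤ circDist z z') →
        ∀ A ∈ carEvenSubalgebra (orbSet (slab i₀ S₁)), ∀ B ∈ carEvenSubalgebra (orbSet (slab i₀ S₂)),
          ‖star ψ ⬝ᵥ ((A * B) *ᵥ ψ) - (star ψ ⬝ᵥ (A *ᵥ ψ)) * (star ψ ⬝ᵥ (B *ᵥ ψ))‖ ≤
            Ccl * (L : ℝ) ^ d * ‖A‖ * ‖B‖ * Real.exp (-(r : ℝ) / ξ))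
    (hdress : ∀ (d : ℕ) (t U μ g : ℝ), 0 < g → ∀ kK : ℕ, ∃ AK : ℝ, 0 ≤ AK ∧
      ∀ (L : ℕ) [NeZero L] (i₀ : Fin d) (σ : Fin 2) (ψ : Fock (Orb (FermionTorus d L))),
        64 ≤ L → (hubbardTorusWith d L t U μ).HasSpectralGap g →
        (hubbardTorusWith d L t U μ).IsGroundStateVector ψ → star ψ ⬝ᵥ ψ = 1 →
        ∃ (Km Kp : Matrix (Finset (Orb (FermionTorus d L))) (Finset (Orb (FermionTorus d L))) ℂ) (q : ℝ),
          Km.IsHermitian ∧ Kp.IsHermitian ∧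
          Km ∈ carEvenSubalgebra (orbSet (slab i₀ (zIco L (-((L / 16 : ℕ) : ℤ)) ((L / 16 : ℕ) + 1)))) ∧
          Kp ∈ carEvenSubalgebra (orbSet (slab i₀
            (zIco L (((L / 2 : ℕ) : ℤ) - 1 - (L / 16 : ℕ)) ((L / 2 : ℕ) + (L / 16 : ℕ))))) ∧
          ‖Km‖ ≤ AK * (L : ℝ) ^ d ∧
          eucNorm ((setCharge σ (slab i₀ (zIco L 0 (L / 2 : ℕ))) - Km - Kp) *ᵥ ψ - (q : ℂ) • ψ) ≤
            AK / (L : ℝ) ^ kK) :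
    bbdf2019_lsm_filling_hubbardTorus := by
  intro d t U μ g L hd hg hL hgap k
  obtain ⟨Ccl, ξ, r₀, hξ, hCcl, hcl⟩ := hclus d t U μ g hg
  obtain ⟨AK, hAK, hdr⟩ := hdress d t U μ g hg (2 * k + d)
  -- constants
  set c : ℝ := 1 / (16 * ξ) with hcdef
  have hc0 : 0 < c := by positivity
  set p : ℕ := 2 * k + 2 * d with hpdef
  set K : ℝ := AK + Ccl * Real.exp (1 / ξ) * (p.factorial / c ^ p) with hKdef
  have hK0 : 0 ≤ K := by positivity
  set C₁ : ℝ := 4 * π ^ 2 * (1 + 2 * AK) * K + Real.sqrt π * Real.sqrt K + π * K with hC₁def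
  have hC₁0 : 0 ≤ C₁ := by positivity
  set L₁ : ℕ := max 64 (16 * r₀ + 16) with hL₁def
  refine ⟨C₁ + (L₁ : ℝ) ^ k, fun j N M ψ hψ hmem => ?_⟩
  have hLj2 : 2 ≤ L j := (hL j).2
  have hLj0 : 0 < L j := by omega
  have hLr1 : (1 : ℝ) ≤ L j := by exact_mod_cast hLj0
  have hLrpos : (0 : ℝ) < (L j : ℝ) ^ k := by positivity
  -- the trivial bound for small volumes, and the reduction of the goal to a bound `C₁ / L^k`
  have htriv : ∀ x : ℝ, ∃ n : ℤ, |x - n| ≤ 1 / 2 := fun x => ⟨round x, abs_sub_round x⟩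
  have hgoal : ∀ x : ℝ, (L₁ ≤ L j → ∃ n : ℤ, |x - n| ≤ C₁ / (L j : ℝ) ^ k) →
      ∃ n : ℤ, |x - n| ≤ (C₁ + (L₁ : ℝ) ^ k) / (L j : ℝ) ^ k := by
    intro x hx
    by_cases hsmall : L j < L₁
    · obtain ⟨n, hn⟩ := htriv x
      refine ⟨n, hn.trans ?_⟩
      rw [le_div_iff₀ hLrpos]
      have h1 : ((L j : ℝ)) ^ k ≤ (L₁ : ℝ) ^ k :=
        pow_le_pow_left₀ (by positivity) (by exact_mod_cast hsmall.le) k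
      nlinarith
    · obtain ⟨n, hn⟩ := hx (not_lt.1 hsmall)
      refine ⟨n, hn.trans (div_le_div_of_nonneg_right ?_ hLrpos.le)⟩
      have : (0 : ℝ) ≤ (L₁ : ℝ) ^ k := by positivity
      linarith
  -- the main estimate at a large volume, for either spin
  have main : ∀ σ : Fin 2, L₁ ≤ L j →
      ∃ n : ℤ, |(if σ = 0 then (N : ℝ) / 2 + M else (N : ℝ) / 2 - M) / (L j) - n| ≤ C₁ / (L j : ℝ) ^ k := by
    intro σ hLj
    haveI : NeZero (L j) := ⟨hLj0.ne'⟩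
    have h64 : 64 ≤ L j := le_trans (le_max_left _ _) hLj
    have hr₀ : 16 * r₀ + 16 ≤ L j := le_trans (le_max_right _ _) hLj
    -- normalise the ground state
    obtain ⟨ψ₁, hψ₁, hmem₁, hψ₁1⟩ := exists_unit_groundStateVector hψ hmem
    set i₀ : Fin d := ⟨0, hd⟩ with hi₀
    -- the local charge fluctuations
    obtain ⟨Km, Kp, q, hKmh, hKph, hKm_mem, hKp_mem, hKmn, happ⟩ :=
      hdr (L j) i₀ σ ψ₁ h64 (hgap j) hψ₁ hψ₁1
    set w : ℕ := L j / 16 with hwdef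
    set h : ℕ := L j / 2 with hhdef
    have hw : 1 ≤ w := by omega
    have hwh : 5 * w + 2 ≤ h := by omega
    have hhL : 2 * h ≤ L j := by omega
    have hr₀w : r₀ ≤ w := by omega
    have hLw : L j < 16 * w + 16 := by omega
    -- clustering between the two strips, at periodic distance `≥ w`
    set δ : ℝ := Ccl * (L j : ℝ) ^ d * Real.exp (-(w : ℝ) / ξ) with hδdef
    have hδ0 : 0 ≤ δ := by positivity
    have hsep : ∀ z ∈ zIco (L j) (-(w : ℤ)) (2 * w + 1), ∀ z' ∈ zIco (L j) ((h : ℤ) - 2 * w - 1) (h + w + 1),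
        w ≤ circDist z z' := by
      intro z hz z' hz'
      have hw' : (1 : ℤ) ≤ w := by exact_mod_cast hw
      have hwh' : 5 * (w : ℤ) + 2 ≤ h := by exact_mod_cast hwh
      have hhL' : 2 * (h : ℤ) ≤ L j := by exact_mod_cast hhL
      exact le_circDist_of_mem_zIco (by linarith) (by linarith) (by linarith) (by linarith) hz hz'
    have hcl' : ∀ a ∈ carEvenSubalgebra (orbSet (slab i₀ (zIco (L j) (-(w : ℤ)) (2 * w + 1)))),
        ∀ b ∈ carEvenSubalgebra (orbSet (slab i₀ (zIco (L j) ((h : ℤ) - 2 * w - 1) (h + w + 1)))),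
          ‖star ψ₁ ⬝ᵥ ((a * b) *ᵥ ψ₁) - (star ψ₁ ⬝ᵥ (a *ᵥ ψ₁)) * (star ψ₁ ⬝ᵥ (b *ᵥ ψ₁))‖ ≤
            δ * ‖a‖ * ‖b‖ := by
      intro a ha b hb
      have h1 := hcl (L j) i₀ ψ₁ (hgap j) hψ₁ hψ₁1 _ _ w hr₀w hsep a ha b hb
      rw [hδdef]
      calc _ ≤ Ccl * (L j : ℝ) ^ d * ‖a‖ * ‖b‖ * Real.exp (-(w : ℝ) / ξ) := h1
        _ = Ccl * (L j : ℝ) ^ d * Real.exp (-(w : ℝ) / ξ) * ‖a‖ * ‖b‖ := by ring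
    -- the index theorem at this volume
    have hε0 : (0 : ℝ) ≤ AK / (L j : ℝ) ^ (2 * k + d) := by positivity
    obtain ⟨m, hm⟩ := lsm_index_core i₀ (hgap j) hψ₁ hψ₁1 hmem₁ σ hw hwh hhL hKmh hKph hKm_mem hKp_mem
      hε0 happ hδ0 hcl'
    refine ⟨m, hm.trans ?_⟩
    -- the analytic estimate
    set Lr : ℝ := (L j : ℝ) with hLrdef
    set ε : ℝ := AK / Lr ^ (2 * k + d) with hεdef
    have hLr64 : (64 : ℝ) ≤ Lr := by rw [hLrdef]; exact_mod_cast h64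
    have hLr0 : 0 < Lr := by linarith
    have hε0' : 0 ≤ ε := by positivity
    -- `(ε + δ) L^{2k+d} ≤ K`
    have hwr : Lr / 16 - 1 ≤ (w : ℝ) := by
      have : (L j : ℝ) < 16 * (w : ℝ) + 16 := by exact_mod_cast hLw
      rw [hLrdef]; linarith
    have hexpw : Real.exp (-(w : ℝ) / ξ) ≤ Real.exp (1 / ξ) * Real.exp (-(c * Lr)) := by
      rw [← Real.exp_add]
      refine Real.exp_le_exp.2 ?_
      rw [hcdef]
      have e1 : -(w : ℝ) / ξ = (-(w : ℝ)) * (1 / ξ) := by ring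
      have e2 : 1 / ξ + -(1 / (16 * ξ) * Lr) = (1 - Lr / 16) * (1 / ξ) := by ring
      rw [e1, e2]
      exact mul_le_mul_of_nonneg_right (by linarith) (by positivity)
    have hδK : δ * Lr ^ (2 * k + d) ≤ Ccl * Real.exp (1 / ξ) * (p.factorial / c ^ p) := by
      have h1 : Lr ^ p * Real.exp (-(c * Lr)) ≤ p.factorial / c ^ p := pow_mul_exp_neg_le hc0 p hLr0.le
      calc δ * Lr ^ (2 * k + d) = Ccl * Lr ^ p * Real.exp (-(w : ℝ) / ξ) := by
            rw [hδdef, hpdef]; ring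
        _ ≤ Ccl * Lr ^ p * (Real.exp (1 / ξ) * Real.exp (-(c * Lr))) := by gcongr
        _ = Ccl * Real.exp (1 / ξ) * (Lr ^ p * Real.exp (-(c * Lr))) := by ring
        _ ≤ Ccl * Real.exp (1 / ξ) * (p.factorial / c ^ p) := by gcongr
    have hεK : ε * Lr ^ (2 * k + d) = AK := by
      rw [hεdef]; field_simp
    have hXK : (ε + δ) * Lr ^ (2 * k + d) ≤ K := by
      rw [add_mul, hεK, hKdef]; linarith
    have hpow_pos : 0 < Lr ^ (2 * k + d) := by positivity
    have hX : ε + δ ≤ K / Lr ^ (2 * k + d) := by rwa [le_div_iff₀ hpow_pos]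
    have hX0 : 0 ≤ ε + δ := by positivity
    -- comparison of powers of `L`
    have hLk1 : 1 ≤ Lr ^ k := one_le_pow₀ (by linarith)
    have hLkpos : 0 < Lr ^ k := by positivity
    have hpow2 : Lr ^ (2 * k) = (Lr ^ k) ^ 2 := by rw [← pow_mul, mul_comm]
    have hpow_split : Lr ^ (2 * k + d) = Lr ^ (2 * k) * Lr ^ d := pow_add _ _ _
    have h2k_le : (Lr ^ k) ^ 2 ≤ Lr ^ (2 * k + d) := by
      rw [hpow_split, hpow2]
      exact le_mul_of_one_le_right (by positivity) (one_le_pow₀ (by linarith))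
    have hk_le : Lr ^ k ≤ Lr ^ (2 * k + d) := by
      calc Lr ^ k = Lr ^ k * 1 := (mul_one _).symm
        _ ≤ Lr ^ k * Lr ^ k := by gcongr
        _ = (Lr ^ k) ^ 2 := (sq _).symm
        _ ≤ Lr ^ (2 * k + d) := h2k_le
    -- term by term
    have hπ3 : (3 : ℝ) < π := Real.pi_gt_three
    have hπ0 : (0 : ℝ) < π := Real.pi_pos
    have hδ8 : δ ≤ 8 * π * δ := by
      have := mul_le_mul_of_nonneg_right (show (1 : ℝ) ≤ 8 * π by linarith) hδ0
      linarith
    have hδ4 : 2 * δ ≤ 4 * π * δ := mul_le_mul_of_nonneg_right (by linarith) hδ0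
    have hsum1 : 8 * π * ε + δ ≤ 8 * π * (ε + δ) := by linarith
    have hsum2 : 4 * π * ε + 2 * δ ≤ 4 * π * (ε + δ) := by linarith
    have hKk : K / Lr ^ (2 * k + d) ≤ K / Lr ^ k := div_le_div_of_nonneg_left hK0 hLkpos hk_le
    have hT1 : 2 * π * ((8 * π * ε + δ) * (Lr ^ d + 2 * ‖Km‖)) ≤ 16 * π ^ 2 * (1 + 2 * AK) * K / Lr ^ k := by
      have h2 : Lr ^ d + 2 * ‖Km‖ ≤ (1 + 2 * AK) * Lr ^ d := by linarith [hKmn]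
      have h3 : (ε + δ) * Lr ^ d ≤ K / Lr ^ (2 * k) := by
        rw [le_div_iff₀ (pow_pos hLr0 _)]
        calc (ε + δ) * Lr ^ d * Lr ^ (2 * k) = (ε + δ) * Lr ^ (2 * k + d) := by rw [hpow_split]; ring
          _ ≤ K := hXK
      have hk2 : Lr ^ k ≤ (Lr ^ k) ^ 2 := by
        calc Lr ^ k = Lr ^ k * 1 := (mul_one _).symm
          _ ≤ Lr ^ k * Lr ^ k := mul_le_mul_of_nonneg_left hLk1 hLkpos.le
          _ = (Lr ^ k) ^ 2 := (sq _).symm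
      have h4 : K / Lr ^ (2 * k) ≤ K / Lr ^ k := by
        rw [hpow2]
        exact div_le_div_of_nonneg_left hK0 hLkpos hk2
      have h5 : 0 ≤ Lr ^ d + 2 * ‖Km‖ := by
        have := norm_nonneg Km
        have := pow_nonneg hLr0.le d
        linarith
      have h6 : 0 ≤ 8 * π * (ε + δ) := by positivity
      have h7 : (0 : ℝ) ≤ 2 * π := by linarith
      have h8 : (0 : ℝ) ≤ 16 * π ^ 2 * (1 + 2 * AK) := by positivity
      calc 2 * π * ((8 * π * ε + δ) * (Lr ^ d + 2 * ‖Km‖))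
          ≤ 2 * π * ((8 * π * (ε + δ)) * ((1 + 2 * AK) * Lr ^ d)) :=
            mul_le_mul_of_nonneg_left (mul_le_mul hsum1 h2 h5 h6) h7
        _ = 16 * π ^ 2 * (1 + 2 * AK) * ((ε + δ) * Lr ^ d) := by ring
        _ ≤ 16 * π ^ 2 * (1 + 2 * AK) * (K / Lr ^ k) := mul_le_mul_of_nonneg_left (h3.trans h4) h8
        _ = 16 * π ^ 2 * (1 + 2 * AK) * K / Lr ^ k := by ring
    have hT3 : 4 * π * ε + 2 * δ ≤ 4 * π * K / Lr ^ k := by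
      have h7 : (0 : ℝ) ≤ 4 * π := by linarith
      calc 4 * π * ε + 2 * δ ≤ 4 * π * (ε + δ) := hsum2
        _ ≤ 4 * π * (K / Lr ^ k) := mul_le_mul_of_nonneg_left (hX.trans hKk) h7
        _ = 4 * π * K / Lr ^ k := by ring
    have hT2 : 2 * Real.sqrt (4 * π * ε + 2 * δ) ≤ 4 * Real.sqrt π * Real.sqrt K / Lr ^ k := by
      have h1 : 4 * π * ε + 2 * δ ≤ 4 * π * (K / Lr ^ (2 * k + d)) := by
        have h7 : (0 : ℝ) ≤ 4 * π := by linarith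
        exact hsum2.trans (mul_le_mul_of_nonneg_left hX h7)
      have h2 : Real.sqrt (K / Lr ^ (2 * k + d)) ≤ Real.sqrt K / Lr ^ k := sqrt_div_le_sqrt_div hK0 hLkpos h2k_le
      have h4 : Real.sqrt 4 = 2 := by
        rw [show (4 : ℝ) = 2 ^ 2 by norm_num, Real.sqrt_sq (by norm_num)]
      calc 2 * Real.sqrt (4 * π * ε + 2 * δ) ≤ 2 * Real.sqrt (4 * π * (K / Lr ^ (2 * k + d))) :=
            mul_le_mul_of_nonneg_left (Real.sqrt_le_sqrt h1) (by norm_num)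
        _ = 2 * (Real.sqrt 4 * Real.sqrt π * Real.sqrt (K / Lr ^ (2 * k + d))) := by
            rw [Real.sqrt_mul (by positivity), Real.sqrt_mul (by norm_num)]
        _ = 4 * Real.sqrt π * Real.sqrt (K / Lr ^ (2 * k + d)) := by rw [h4]; ring
        _ ≤ 4 * Real.sqrt π * (Real.sqrt K / Lr ^ k) :=
            mul_le_mul_of_nonneg_left h2 (mul_nonneg (by norm_num) (Real.sqrt_nonneg _))
        _ = 4 * Real.sqrt π * Real.sqrt K / Lr ^ k := by ring
    have h4pos : (0 : ℝ) < 4 := by norm_num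
    rw [div_le_iff₀ h4pos]
    have hsum := add_le_add (add_le_add hT1 hT2) hT3
    have e : 16 * π ^ 2 * (1 + 2 * AK) * K / Lr ^ k + 4 * Real.sqrt π * Real.sqrt K / Lr ^ k +
        4 * π * K / Lr ^ k = C₁ / Lr ^ k * 4 := by
      rw [hC₁def]; field_simp; ring
    linarith
  constructor
  · have h0 := hgoal _ (main 0)
    simpa using h0
  · have h1 := hgoal _ (main 1)
    simpa using h1

end Assembly

end Literature.MathematicalPhysics.QuantumLattice

end
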